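import Mathlib
import Literature.Probability.Percolation.TriCorrLengthExponentDecomposition
import HarnessLib

/-!
# Four-arm smallness at a large fixed aspect ratio (crux `MagicFormulaT`, line `Sketch` v7,
# registered sub-goal `ribbon_fourArmSmall` of `stub_ribbonRarity`)

Crux `Summit.CriticalPhenomena.CardyFormulaZ2.Theses.CardyMagicRigidity.MagicFormulaT`
(stmt-CriticalPhenomena-4836), line `Sketch`, skeleton v7.  The Peierls bound for ribbon rarity in
critical site percolation on `𝕋` (two distinct macroscopic interface loops globally `2ε`-close force
alternating four-arm events around every point of a coarse skeleton path) bounds the probability by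
`(#roots) · (A L)^k · q^k`, with `q` the probability of four alternating arms across an annulus of
inner lattice radius `ρ → ∞` and fixed aspect ratio `L`; the chain converges as soon as
`A · L · π₄(ρ, ρ L) ≤ 1` for all large `ρ`.  This is exactly what the Smirnov–Werner scaling limit
`SmirnovWerner2001_fourArm_scalingLimit` (a named fact of the tree: the limits
`b'(L) = lim_ρ π₄(ρ, ρ L)` exist and `log b'(λ) / log λ → -5/4`, an exponent `> 1`) provides:
eventually `log b'(L) < -(9/8) log L`, so `A · L · b'(L) < A · L^{-1/8} ≤ 1` once `L ≥ A⁸`, and the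
eventual-in-`ρ` bound follows from the convergence `π₄(ρ, ρ L) → b'(L)`.

Main statement: `ribbon_fourArmSmall`.
-/

noncomputable section

namespace Summit.CriticalPhenomena.CardyFormulaZ2.Cruxes.MagicFormulaT.LineSketch

open MeasureTheory Filter Set
open scoped Real Topology BigOperators ENNReal
open Literature.Probability.RandomPlanarGeometry Literature.Probability.Percolation
  Literature.Probability.LatticeModels

/-- Real-analysis core of `ribbon_fourArmSmall`: if `log (b l) / log l → -5/4` as `l → ∞` (any
exponent `< -1` would do) then for every `A > 0` there is a natural number `L ≥ 2` with
`A · L · b L < 1`.  Indeed eventually `log (b L) < -(9/8) log L`; for `L ≥ A⁸` with `b L > 0` this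
gives `log A + log L + log (b L) < log A - (1/8) log L ≤ 0`, and `b L ≤ 0` is trivial. -/
theorem exists_nat_two_le_mul_mul_lt_one {b : ℝ → ℝ}
    (hexp : Tendsto (fun l : ℝ => Real.log (b l) / Real.log l) atTop (𝓝 (-(5 / 4))))
    {A : ℝ} (hA : 0 < A) :
    ∃ L : ℕ, 2 ≤ L ∧ A * L * b L < 1 := by
  -- pass to natural aspect ratios and extract one beyond all thresholds
  have h1 : Tendsto (fun K : ℕ => Real.log (b K) / Real.log (K : ℝ)) atTop (𝓝 (-(5 / 4))) :=
    hexp.comp tendsto_natCast_atTop_atTop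
  obtain ⟨L, ⟨hLexp, hL2⟩, hLA⟩ :=
    (((h1.eventually_lt_const (by norm_num : (-(5 / 4) : ℝ) < -(9 / 8))).and
      (eventually_ge_atTop 2)).and (eventually_ge_atTop ⌈A ^ 8⌉₊)).exists
  refine ⟨L, hL2, ?_⟩
  have hL2R : (2 : ℝ) ≤ L := by exact_mod_cast hL2
  have hLAR : A ^ 8 ≤ (L : ℝ) := (Nat.le_ceil (A ^ 8)).trans (by exact_mod_cast hLA)
  have hLpos : (0 : ℝ) < L := by linarith
  have hlogL : 0 < Real.log (L : ℝ) := Real.log_pos (by linarith)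
  -- `log (b L) < -(9/8) log L`
  have hkey : Real.log (b L) < -(9 / 8) * Real.log (L : ℝ) := (div_lt_iff₀ hlogL).1 hLexp
  rcases le_or_gt (b L) 0 with hb | hb
  · -- nonpositive limit value: the product is `≤ 0 < 1`
    have : A * L * b L ≤ 0 := mul_nonpos_of_nonneg_of_nonpos (by positivity) hb
    linarith
  · -- positive limit value: compare logarithms
    have hlogA : Real.log (A ^ 8) ≤ Real.log (L : ℝ) := Real.log_le_log (pow_pos hA 8) hLAR
    rw [Real.log_pow] at hlogA
    push_cast at hlogA
    have hprod : 0 < A * L * b L := by positivity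
    rw [← Real.log_neg_iff hprod, Real.log_mul (by positivity) hb.ne',
      Real.log_mul hA.ne' hLpos.ne']
    linarith

/-- **Four-arm smallness at a large fixed aspect ratio** (registered sub-goal `ribbon_fourArmSmall`
of `stub_ribbonRarity`, crux stmt-CriticalPhenomena-4836, line `Sketch` v7): assuming the
Smirnov–Werner scaling limit of the critical alternating four-arm probabilities of site percolation
on `𝕋` with its `SLE₆` exponent `5/4` (`SmirnovWerner2001_fourArm_scalingLimit`, taken as an
explicit hypothesis), for every `A > 0` there is an aspect ratio `L ≥ 2` such that
`A · L · π₄(ρ, ρ L) ≤ 1` for all large inner radii `ρ`, where `π₄ = critFourArmProb`.  This is the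
input that makes the Peierls chain for ribbon rarity converge (four-arm exponent `> 1`). -/
theorem ribbon_fourArmSmall : SmirnovWerner2001_fourArm_scalingLimit → ∀ A : ℝ, 0 < A →
    ∃ L : ℕ, 2 ≤ L ∧ ∀ᶠ ρ : ℕ in Filter.atTop, A * L * critFourArmProb ρ (ρ * L) ≤ 1 := by
  rintro ⟨b', hlim, hexp⟩ A hA
  obtain ⟨L, hL2, hlt⟩ := exists_nat_two_le_mul_mul_lt_one hexp hA
  refine ⟨L, hL2, ?_⟩
  -- the four-arm probabilities at aspect ratio `L` converge to `b' L`
  have hconv : Tendsto (fun ρ : ℕ => critFourArmProb ρ (ρ * L)) atTop (𝓝 (b' L)) := by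
    simpa using hlim 1 L le_rfl (by omega)
  have hconv' : Tendsto (fun ρ : ℕ => A * L * critFourArmProb ρ (ρ * L)) atTop
      (𝓝 (A * L * b' L)) := hconv.const_mul (A * L)
  exact (hconv'.eventually_lt_const hlt).mono fun ρ h => h.le

end Summit.CriticalPhenomena.CardyFormulaZ2.Cruxes.MagicFormulaT.LineSketch
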